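import Mathlib
import Literature.NumberTheory.Sieve.Maynard2016TupleArith
import Literature.NumberTheory.LFunctions.MertensSecondLogPower
import HarnessLib

/-!
# Maynard 2016, Lemma 7: the number of primes `q ∈ 𝓘_m`

Topic `Literature/NumberTheory/Sieve`. J. Maynard, *Large gaps between primes*, Ann. of Math. (2)
183 (2016), 915–933 = arXiv:1408.5110, §6, proof of Lemma 7, between (6.29) and (6.30):
"`𝓘_m` is an interval of length `δ|𝓡_m| log x ≫ x(log x)^{−2}` by Lemma 3 and our bound on `m`.
Since `𝓘_m` is contained in `[x/2, x]`, the number of primes in `𝓘_m` is `(1+o(1))|𝓘_m|/log x` by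
the prime number theorem."

PROVED here (no named facts), from the prime number theorem with de la Vallée Poussin's error term
in the form `|ϑ(t) − t| ≤ C t/(log t)^n` (tree:
`Literature.NumberTheory.LFunctions.Mertens.exists_abs_theta_sub_le_div_log_pow`, itself from
`ChebyshevThetaDeLaValleePoussin_holds`): `theta_sub_theta_eq`, `Ioc_filter_prime_subset_intervalPrimes`,
`theta_sub_theta_le_card_mul_log`, and the lower count
`eventually_card_intervalPrimes_ge : ∀ n, ∀ κ > 0, ∀ᶠ x, ∀ A B, x/2 ≤ A → B ≤ x → x/(log x)^n ≤ B − A →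
(1 − κ)(B − A)/log x ≤ #{q prime : A ≤ q ≤ B}` (the direction used in the lower bound (6.32)).

## References

* J. Maynard, *Large gaps between primes*, Ann. of Math. (2) 183 (2016), 915–933; arXiv:1408.5110,
  Lemma 7 (proof, between (6.29) and (6.30)). [Maynard2016LargeGaps]
* H. L. Montgomery, R. C. Vaughan, *Multiplicative Number Theory I*, CUP 2007, Theorem 6.9.
  [MontgomeryVaughan2007]
-/

open Filter Finset
open scoped Topology

namespace Literature.NumberTheory.Sieve

namespace Maynard2016

/-- `ϑ(B) − ϑ(A) = Σ_{⌊A⌋ < p ≤ ⌊B⌋} log p` for `A ≤ B`. [cite: MontgomeryVaughan2007, §2.2 (definition of ϑ)] -/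
theorem theta_sub_theta_eq {A B : ℝ} (h : A ≤ B) :
    Chebyshev.theta B - Chebyshev.theta A =
      ∑ p ∈ (Finset.Ioc ⌊A⌋₊ ⌊B⌋₊).filter Nat.Prime, Real.log p := by
  have hfl : ⌊A⌋₊ ≤ ⌊B⌋₊ := Nat.floor_mono h
  have hθ : ∀ t : ℝ, Chebyshev.theta t =
      ∑ p ∈ (Finset.Ioc 0 ⌊t⌋₊).filter Nat.Prime, Real.log p := fun t => rfl
  have e : ∀ a b : ℕ, ∑ p ∈ (Finset.Ioc a b).filter Nat.Prime, Real.log p =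
      ∑ n ∈ Finset.Ioc a b, (if n.Prime then Real.log n else 0) := fun a b => Finset.sum_filter _ _
  rw [hθ, hθ, e, e, e, ← Finset.sum_Ioc_consecutive _ (Nat.zero_le _) hfl]
  ring

/-- The primes of `(⌊A⌋, ⌊B⌋]` belong to `{q prime : A ≤ q ≤ B}`. [cite: Maynard2016LargeGaps, Lemma 7 (definition of 𝓘_m)] -/
theorem Ioc_filter_prime_subset_intervalPrimes (A B : ℝ) :
    (Finset.Ioc ⌊A⌋₊ ⌊B⌋₊).filter Nat.Prime ⊆ intervalPrimes A B := by
  intro p hp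
  simp only [Finset.mem_filter, Finset.mem_Ioc] at hp
  unfold intervalPrimes
  simp only [Finset.mem_filter, Finset.mem_Icc]
  exact ⟨⟨(Nat.ceil_le_floor_add_one A).trans (by omega), hp.1.2⟩, hp.2⟩

/-- `ϑ(B) − ϑ(A) ≤ #{q prime : A ≤ q ≤ B} · log B` for `1 ≤ A ≤ B`. [cite: MontgomeryVaughan2007, §2.2 (definition of ϑ)] -/
theorem theta_sub_theta_le_card_mul_log {A B : ℝ} (hA : 1 ≤ A) (hAB : A ≤ B) :
    Chebyshev.theta B - Chebyshev.theta A ≤ ((intervalPrimes A B).card : ℝ) * Real.log B := by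
  rw [theta_sub_theta_eq hAB]
  have hB0 : 0 ≤ B := by linarith
  calc ∑ p ∈ (Finset.Ioc ⌊A⌋₊ ⌊B⌋₊).filter Nat.Prime, Real.log p
      ≤ ∑ p ∈ (Finset.Ioc ⌊A⌋₊ ⌊B⌋₊).filter Nat.Prime, Real.log B := by
        refine Finset.sum_le_sum fun p hp => ?_
        simp only [Finset.mem_filter, Finset.mem_Ioc] at hp
        have hp0 : (0 : ℝ) < p := by exact_mod_cast hp.2.pos
        exact Real.log_le_log hp0 (le_trans (by exact_mod_cast hp.1.2) (Nat.floor_le hB0))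
    _ = (((Finset.Ioc ⌊A⌋₊ ⌊B⌋₊).filter Nat.Prime).card : ℝ) * Real.log B := by
        rw [Finset.sum_const, nsmul_eq_mul]
    _ ≤ ((intervalPrimes A B).card : ℝ) * Real.log B :=
        mul_le_mul_of_nonneg_right
          (by exact_mod_cast Finset.card_le_card (Ioc_filter_prime_subset_intervalPrimes A B))
          (Real.log_nonneg (by linarith))

/-- **The number of primes in `𝓘_m` (lower count).** For every `n` and `κ > 0`, for all large `x`:
if `x/2 ≤ A`, `B ≤ x` and `B − A ≥ x/(log x)^n` then `#{q prime : A ≤ q ≤ B} ≥ (1 − κ)(B − A)/log x`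
(prime number theorem with de la Vallée Poussin's error term).
[cite: Maynard2016LargeGaps, Lemma 7 (proof, «the number of primes in 𝓘_m is (1+o(1))|𝓘_m|/log x»)] -/
theorem eventually_card_intervalPrimes_ge (n : ℕ) {κ : ℝ} (hκ : 0 < κ) :
    ∀ᶠ x : ℕ in atTop, ∀ A B : ℝ, (x : ℝ) / 2 ≤ A → B ≤ x → (x : ℝ) / Real.log x ^ n ≤ B - A →
      (1 - κ) * ((B - A) / Real.log x) ≤ ((intervalPrimes A B).card : ℝ) := by
  obtain ⟨C, hC0, hC⟩ :=
    Literature.NumberTheory.LFunctions.Mertens.exists_abs_theta_sub_le_div_log_pow (n + 2)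
  have hT : Tendsto (fun X : ℝ => κ * (Real.log X) ^ 2) atTop atTop :=
    ((tendsto_pow_atTop two_ne_zero).comp Real.tendsto_log_atTop).const_mul_atTop hκ
  have hreal : ∀ᶠ X : ℝ in atTop, 4 ≤ X ∧ 2 * Real.log 2 ≤ Real.log X ∧
      2 ^ (n + 3) * C ≤ κ * Real.log X ^ 2 := by
    filter_upwards [eventually_ge_atTop 4, Real.tendsto_log_atTop.eventually_ge_atTop (2 * Real.log 2),
      hT.eventually_ge_atTop (2 ^ (n + 3) * C)] with X h1 h2 h3
    exact ⟨h1, h2, h3⟩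
  filter_upwards [tendsto_natCast_atTop_atTop.eventually hreal] with x hx
  obtain ⟨hx4, hlog2, hbig⟩ := hx
  intro A B hA hB hBA
  set L := Real.log x with hLdef
  have hl2 : 0 < Real.log 2 := Real.log_pos one_lt_two
  have hL0 : 0 < L := by linarith
  have hxpos : (0 : ℝ) < x := by linarith
  have hA2 : 2 ≤ A := by linarith
  have hAB : A ≤ B := by
    have : 0 ≤ (x : ℝ) / L ^ n := by positivity
    linarith
  -- `log A, log B ≥ L/2`
  have hlogA : L / 2 ≤ Real.log A := by
    have h1 : Real.log (x / 2) ≤ Real.log A := Real.log_le_log (by positivity) hA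
    rw [Real.log_div hxpos.ne' two_ne_zero] at h1
    linarith
  -- the error at any `t ∈ [A, B]`
  have herr : ∀ t : ℝ, A ≤ t → t ≤ B →
      |Chebyshev.theta t - t| ≤ C * x / (L / 2) ^ (n + 2) := by
    intro t h1 h2
    refine (hC t (by linarith)).trans ?_
    have hlt : L / 2 ≤ Real.log t := hlogA.trans (Real.log_le_log (by linarith) h1)
    have hL2pos : 0 < L / 2 := by linarith
    have hlogt : 0 < Real.log t := lt_of_lt_of_le hL2pos hlt
    calc C * t / Real.log t ^ (n + 2) ≤ C * x / Real.log t ^ (n + 2) :=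
          div_le_div_of_nonneg_right (mul_le_mul_of_nonneg_left (h2.trans hB) hC0)
            (pow_nonneg hlogt.le _)
      _ ≤ C * x / (L / 2) ^ (n + 2) :=
          div_le_div_of_nonneg_left (by positivity) (pow_pos hL2pos _)
            (pow_le_pow_left₀ hL2pos.le hlt _)
  have hθ : (B - A) - 2 * (C * x / (L / 2) ^ (n + 2)) ≤
      Chebyshev.theta B - Chebyshev.theta A := by
    have h1 := herr A le_rfl hAB
    have h2 := herr B hAB le_rfl
    rw [abs_le] at h1 h2
    linarith [h1.1, h1.2, h2.1, h2.2]
  -- the error is `≤ κ (B − A)`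
  have hsmall : 2 * (C * x / (L / 2) ^ (n + 2)) ≤ κ * (B - A) := by
    have e : 2 * (C * x / (L / 2) ^ (n + 2)) = (2 ^ (n + 3) * C) * x / L ^ (n + 2) := by
      rw [div_pow]
      field_simp
      ring
    rw [e]
    calc (2 ^ (n + 3) * C) * x / L ^ (n + 2) ≤ (κ * L ^ 2) * x / L ^ (n + 2) :=
          div_le_div_of_nonneg_right (mul_le_mul_of_nonneg_right hbig hxpos.le) (pow_nonneg hL0.le _)
      _ = κ * ((x : ℝ) / L ^ n) := by
          field_simp
          ring
      _ ≤ κ * (B - A) := mul_le_mul_of_nonneg_left hBA hκ.le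
  -- the count
  have hcard := theta_sub_theta_le_card_mul_log (by linarith : (1 : ℝ) ≤ A) hAB
  have hlogBx : Real.log B ≤ L := Real.log_le_log (by linarith) hB
  have hIP : Chebyshev.theta B - Chebyshev.theta A ≤ ((intervalPrimes A B).card : ℝ) * L :=
    hcard.trans (mul_le_mul_of_nonneg_left hlogBx (Nat.cast_nonneg _))
  rw [show (1 - κ) * ((B - A) / L) = ((1 - κ) * (B - A)) / L by ring, div_le_iff₀ hL0]
  linarith

end Maynard2016

end Literature.NumberTheory.Sieve
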